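import Mathlib.Analysis.CStarAlgebra.Spectrum
import Mathlib.Analysis.CStarAlgebra.ContinuousFunctionalCalculus.Order
import Literature.MathematicalPhysics.QuantumLattice.ErgodicStatesODLRO
import Literature.MathematicalPhysics.QuantumLattice.InfVolFermionStateBounds
import Literature.MathematicalPhysics.QuantumLattice.FermionEmbedLocality
import Literature.MathematicalPhysics.QuantumLattice.HubbardJordanWignerLocality
import HarnessLib

/-!
# Ergodic states are weakly mixing in mean; discharge of `ergodic_pairCorr_boxAverage`

Topic `Literature/MathematicalPhysics/QuantumLattice`; namespace
`Literature.MathematicalPhysics.QuantumLattice` (the file path). Companion PROOF file of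
`ErgodicStatesODLRO.lean`: the named fact `InfVolFermionState.ergodic_pairCorr_boxAverage`
(Bratteli–Robinson I Thm. 4.3.17 with Prop. 4.3.4, for the `ℤ²`-abelian pair (CAR algebra,
translation-invariant state) of Bratteli–Robinson II Ex. 5.2.21) is DISCHARGED:
`InfVolFermionState.ergodic_pairCorr_boxAverage_holds`. Everything here is a theorem; no
definition, no named fact.

## The printed result and the route taken

Bratteli–Robinson I, Thm. 4.3.17 (PDF p. 395): for a `G`-invariant state `ω`, with `E_ω` the
projection onto the `U_ω(G)`-invariant vectors of the GNS space, (1) `E_ω` has rank one ⇒ (2) `ω` is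
`G`-ergodic (extremal invariant), and (2) ⇒ (1) when the pair `(𝔄, ω)` is `G`-abelian;
Thm. 4.3.22 (PDF p. 401): `E_ω` has rank one iff the two-point cluster property in mean
`inf_{B' ∈ Co τ_G(B)} |ω(A B') - ω(A) ω(B)| = 0` holds, the net `B'` being given by the mean ergodic
theorem (Prop. 4.3.4, PDF p. 377) — for the amenable group `G = ℤ^d`, by Følner (box) averages.
For the lattice fermions every translation-invariant state gives a `ℤ^d`-abelian pair, because EVEN
local observables commute with everything localised far away (Bratteli–Robinson II §5.2.2; the
tree's `commute_fermionEmbed_of_mem_carEvenSubalgebra`).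

The tree's carrier `InfVolFermionState d` is a compatible family of local states WITHOUT a GNS
space, so the proof below renders the same mechanism GNS-free (a deviation in form, not in
substance): for an even local `B` and the Fejér (box-pair) averages
`W_N(B) = N^{-2d} Σ_{x,y ∈ [0,N)^d} τ_{y-x}(B)`, the functionals `A ↦ lim_𝒰 ω(A · W_N(B))` along a
free ultrafilter `𝒰` are — for `0 ≤ B ≤ 1` — POSITIVE (graded asymptotic abelianness: the
commutator `[A, W_N(B)]` only sees the `O(N^d)` pairs with `y - x` near `supp A - supp B`),
TRANSLATION INVARIANT (the boxes are Følner: `#{y ∈ [0,N)^d : y + v ∉ [0,N)^d} ≤ |v|₁ N^{d-1}`),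
compatible, and they sum (over `B` and `1 - B`) to `ω`; so they are the two halves of a convex
decomposition of `ω` into translation-invariant states, and EXTREMALITY of `ω` forces
`lim_𝒰 ω(A · W_N(B)) = ω(A) ω(B)`. (In GNS language these functionals are
`A ↦ (Ω_ω, π_ω(A) E_ω π_ω(B) Ω_ω)`, positive because `E_ω π_ω(𝔄) E_ω` is abelian for a
`G`-abelian pair; the argument is the `(2) ⇒ (1)` half of Thm. 4.3.17 unwound.) Linearity in `B`
removes the order restriction, `tendsto_iff_ultrafilter` removes `𝒰`, and `B = P_0`, `A = P_0⋆`
with translation invariance of the pair two-point function gives the fact.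

## Contents

* §1 `card_filter_halfOpenBox_add_not_mem_le` — the Følner bound for the half-open boxes.
* §2 translates `Γ(τ_z) B` of local observables: composition, translation-invariant expectations,
  `IsTranslationInvariant.corr_shiftEmb_left` (`ω(τ_v A · τ_z B) = ω(A · τ_{z-v} B)`), graded
  locality `commute_fermionEmbed_incl_of_disjoint`, contractivity `norm_fermionEmbed_le`,
  `norm_corr_le`.
* §3 ultrafilter limits of bounded sequences.
* §4 the abstract extremality argument: `exists_isTranslationInvariant_of_approximants` (a family of
  approximately positive / invariant / normalised local functionals has, along a free ultrafilter,
  a translation-invariant STATE as its limit) and `IsErgodic.limUnder_eq_of_approximants`.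
* §5 the Fejér functionals `N^{-2d} Σ_{x,y} ω(A · τ_{y-x} B)`: boundedness, normalisation,
  compatibility, the translation defect `≤ 2|v|₁ ‖A‖ ‖B‖ / N`, the positivity defect
  `≤ |Λ| |X| ‖A‖² ‖B‖ / N^d`, linearity in `B`.
* §6 **`IsErgodic.tendsto_boxPairAverage_corr`** — for `ω` ergodic, `B` even:
  `N^{-2d} Σ_{x,y ∈ [0,N)^d} ω(A · τ_{y-x} B) → ω(A) ω(B)` (Bratteli–Robinson I Thm. 4.3.17 +
  4.3.22 for the lattice fermions, `d ≥ 1`).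
* §7 **`ergodic_pairCorr_boxAverage_holds`**.

## References

* O. Bratteli, D. W. Robinson, *Operator Algebras and Quantum Statistical Mechanics 1*, 2nd ed.,
  Springer (1987), §4.3.1 (ergodic = extremal invariant, PDF p. 373), Prop. 4.3.4 (PDF p. 377),
  Thm. 4.3.17 (PDF p. 395), Thm. 4.3.22 (PDF p. 401). [BratteliRobinsonI1987]
* O. Bratteli, D. W. Robinson, *Operator Algebras and Quantum Statistical Mechanics 2*, 2nd ed.,
  Springer (1997), §5.2.2 (even elements of disjoint regions commute), Example 5.2.21.
  [BratteliRobinsonII1997]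
* G. L. Sewell, J. Math. Phys. 11 (1970) 1868, §4. [Sewell1970]
-/

noncomputable section

namespace Literature.MathematicalPhysics.QuantumLattice

open Matrix Finset HubbardWave0 Literature.Probability.LatticeModels Filter Topology
open scoped ComplexOrder

variable {d : ℕ}

/-! ### §1. A Følner bound for the half-open boxes -/

/-- One-dimensional count: the points of `[0,N)` leaving `[0,N)` under translation by `k` number at
most `|k|` (they lie in `[0,-k) ∪ [N-k,N)`). [folklore] -/
private theorem card_filter_Ico_add_not_mem_le (N : ℕ) (k : ℤ) :
    #{t ∈ Finset.Ico (0 : ℤ) N | ¬ (0 ≤ t + k ∧ t + k < N)} ≤ k.natAbs := by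
  classical
  calc #{t ∈ Finset.Ico (0 : ℤ) N | ¬ (0 ≤ t + k ∧ t + k < N)}
      ≤ #(Finset.Ico (0 : ℤ) (-k) ∪ Finset.Ico ((N : ℤ) - k) N) := by
        refine card_le_card fun t ht => ?_
        rw [mem_filter, Finset.mem_Ico] at ht
        rw [mem_union, Finset.mem_Ico, Finset.mem_Ico]
        omega
    _ ≤ #(Finset.Ico (0 : ℤ) (-k)) + #(Finset.Ico ((N : ℤ) - k) N) := card_union_le _ _
    _ = (-k).toNat + k.toNat := by
        rw [Int.card_Ico, Int.card_Ico]
        congr 2 <;> ring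
    _ = k.natAbs := by rw [add_comm]; exact Int.toNat_add_toNat_neg_eq_natAbs k

/-- **The half-open boxes are Følner**: for every `v ∈ ℤ^d`,
`#{y ∈ [0,N)^d : y + v ∉ [0,N)^d} ≤ (Σᵢ |vᵢ|) · N^{d-1}` (a point leaving the box has a coordinate
leaving `[0,N)`, and each coordinate slice is a product). Friedli–Velenik 2017 §3.2.1 (the boxes
converge in the sense of van Hove). [cite: FriedliVelenik2017, §3.2.1] -/
theorem card_filter_halfOpenBox_add_not_mem_le (N : ℕ) (v : Site d) :
    #{y ∈ halfOpenBox d N | y + v ∉ halfOpenBox d N} ≤ (∑ i, (v i).natAbs) * N ^ (d - 1) := by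
  classical
  have hsub : {y ∈ halfOpenBox d N | y + v ∉ halfOpenBox d N} ⊆
      Finset.univ.biUnion fun i : Fin d =>
        {y ∈ halfOpenBox d N | ¬ (0 ≤ y i + v i ∧ y i + v i < N)} := by
    intro y hy
    rw [mem_filter] at hy
    obtain ⟨hy, hv⟩ := hy
    rw [mem_halfOpenBox, not_forall] at hv
    obtain ⟨i, hi⟩ := hv
    exact mem_biUnion.2 ⟨i, mem_univ _, mem_filter.2 ⟨hy, hi⟩⟩
  refine (card_le_card hsub).trans (card_biUnion_le.trans ?_)
  rw [Finset.sum_mul]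
  refine sum_le_sum fun i _ => ?_
  set T : Finset ℤ := {t ∈ Finset.Ico (0 : ℤ) N | ¬ (0 ≤ t + v i ∧ t + v i < N)} with hT
  have hTs : T ⊆ Finset.Ico (0 : ℤ) N := filter_subset _ _
  have hslice : {y ∈ halfOpenBox d N | ¬ (0 ≤ y i + v i ∧ y i + v i < N)} =
      Fintype.piFinset (Function.update (fun _ : Fin d => Finset.Ico (0 : ℤ) N) i T) := by
    rw [Fintype.piFinset_update_eq_filter_piFinset_mem _ _ hTs]
    ext y
    simp only [mem_filter, hT, halfOpenBox, Fintype.mem_piFinset]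
    constructor
    · rintro ⟨h1, h2⟩
      exact ⟨h1, h1 i, h2⟩
    · rintro ⟨h1, -, h2⟩
      exact ⟨h1, h2⟩
  have hupd : (fun j => #(Function.update (fun _ : Fin d => Finset.Ico (0 : ℤ) N) i T j)) =
      Function.update (fun _ : Fin d => #(Finset.Ico (0 : ℤ) (N : ℤ))) i #T := by
    funext j
    by_cases hj : j = i
    · subst hj; simp
    · simp [Function.update_of_ne hj]
  rw [hslice, Fintype.card_piFinset, hupd, Finset.prod_update_of_mem (mem_univ i), prod_const,
    Int.card_Ico, sub_zero, Int.toNat_natCast]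
  have hcard : #(univ \ {i} : Finset (Fin d)) = d - 1 := by
    rw [Finset.card_univ_sdiff, Fintype.card_fin, card_singleton]
  rw [hcard]
  exact Nat.mul_le_mul_right _ (card_filter_Ico_add_not_mem_le N (v i))

/-- Symmetric form: `#([0,N)^d ∖ ([0,N)^d - v)) ≤ |v|₁ N^{d-1}` with the tree's `shiftSet`.
[cite: FriedliVelenik2017, §3.2.1] -/
theorem card_halfOpenBox_sdiff_shiftSet_le (N : ℕ) (v : Site d) :
    #(halfOpenBox d N \ shiftSet (-v) (halfOpenBox d N)) ≤ (∑ i, (v i).natAbs) * N ^ (d - 1) := by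
  classical
  have h : halfOpenBox d N \ shiftSet (-v) (halfOpenBox d N) =
      {y ∈ halfOpenBox d N | y + v ∉ halfOpenBox d N} := by
    ext y
    rw [Finset.mem_sdiff, Finset.mem_filter, mem_shiftSet, sub_neg_eq_add]
  rw [h]
  exact card_filter_halfOpenBox_add_not_mem_le N v

/-! ### §2. Translates of local observables -/

/-- `X + w ⊆ (X + u) + v` for `w = u + v` (an equality of regions, used as an isotony map).
[cite: ArakiMoriya2003, §4.1 Def. 4.3 (τ is a group action)] -/
theorem shiftSet_subset_shiftSet_shiftSet {u v w : Site d} (hw : w = u + v) (X : Finset (Site d)) :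
    shiftSet w X ⊆ shiftSet v (shiftSet u X) := fun x hx => by
  rw [mem_shiftSet, mem_shiftSet, sub_sub, add_comm v u, ← hw]
  exact mem_shiftSet.1 hx

/-- **Translations compose on observables**: `Γ(τ_v) (Γ(τ_u) B) = Γ(τ_{u+v}) B` up to the isotony
identification `X + (u + v) = (X + u) + v`. [cite: ArakiMoriya2003, §4.1 Def. 4.3] -/
theorem fermionEmbed_shiftEmb_shiftEmb {X : Finset (Site d)} {u v w : Site d} (hw : w = u + v)
    (B : FermionOp X) :
    fermionEmbed (PolySite.shiftEmb v (shiftSet u X)) (fermionEmbed (PolySite.shiftEmb u X) B) =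
      fermionEmbed (PolySite.incl (shiftSet_subset_shiftSet_shiftSet hw X))
        (fermionEmbed (PolySite.shiftEmb w X) B) := by
  rw [fermionEmbed_fermionEmbed, fermionEmbed_fermionEmbed,
    fermionEmbed_congr (φ := (PolySite.shiftEmb u X).trans (PolySite.shiftEmb v (shiftSet u X)))
      (ψ := (PolySite.shiftEmb w X).trans
        (PolySite.incl (shiftSet_subset_shiftSet_shiftSet hw X))) (fun y => Subtype.ext (by
        simp only [Function.Embedding.trans_apply, PolySite.coe_shiftEmb, PolySite.coe_incl,
          ofLex_toLex, hw, add_assoc]))]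

/-- `Γ(τ_z) 𝟙 = 𝟙`. [folklore] -/
private theorem fermionEmbed_shiftEmb_one (z : Site d) (X : Finset (Site d)) :
    fermionEmbed (PolySite.shiftEmb z X) (1 : FermionOp X) = 1 :=
  map_one _

namespace InfVolFermionState

variable (ω : InfVolFermionState d)

/-- `ω(A · Γ(⊆) C) = ω(A · C)`: the two-point function is unchanged when the second observable is
first embedded into a larger region. [cite: ArakiMoriya2003, §4.1 Def. 4.1 (2) and Def. 4.5 (states of the quasi-local algebra)] -/
theorem corr_fermionEmbed_incl_right {Λ X X' : Finset (Site d)} (h : X ⊆ X') (A : FermionOp Λ)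
    (C : FermionOp X) : ω.corr A (fermionEmbed (PolySite.incl h) C) = ω.corr A C := by
  have := ω.corr_fermionEmbed_incl (subset_refl Λ) h A C
  rwa [PolySite.incl_rfl, fermionEmbed_refl, AlgHom.coe_id, id] at this

/-- `ω(Γ(⊆) A · C) = ω(A · C)`. [cite: ArakiMoriya2003, §4.1 Def. 4.1 (2) and Def. 4.5 (states of the quasi-local algebra)] -/
theorem corr_fermionEmbed_incl_left {Λ Λ' X : Finset (Site d)} (h : Λ ⊆ Λ') (A : FermionOp Λ)
    (C : FermionOp X) : ω.corr (fermionEmbed (PolySite.incl h) A) C = ω.corr A C := by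
  have := ω.corr_fermionEmbed_incl h (subset_refl X) A C
  rwa [PolySite.incl_rfl, fermionEmbed_refl, AlgHom.coe_id, id] at this

/-- `ω(𝟙 · C) = ω(C)`. [cite: ArakiMoriya2003, §4.1 Def. 4.1 (2) and Def. 4.5 (states of the quasi-local algebra)] -/
theorem corr_one_left {Λ X : Finset (Site d)} (C : FermionOp X) :
    ω.corr (1 : FermionOp Λ) C = ω.expect X C := by
  rw [corr_eq, map_one, one_mul, ω.compatible]

/-- `ω(A · 𝟙) = ω(A)`. [cite: ArakiMoriya2003, §4.1 Def. 4.1 (2) and Def. 4.5 (states of the quasi-local algebra)] -/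
theorem corr_one_right {Λ X : Finset (Site d)} (A : FermionOp Λ) :
    ω.corr A (1 : FermionOp X) = ω.expect Λ A := by
  rw [corr_eq, map_one, mul_one, ω.compatible]

/-- The two-point function is additive in the first observable. [cite: ArakiMoriya2003, §4.1 Def. 4.1 (2) and Def. 4.5 (states of the quasi-local algebra)] -/
theorem corr_add_left {Λ X : Finset (Site d)} (A A' : FermionOp Λ) (C : FermionOp X) :
    ω.corr (A + A') C = ω.corr A C + ω.corr A' C := by
  rw [corr_eq, corr_eq, corr_eq, map_add, add_mul, map_add]

/-- The two-point function is homogeneous in the first observable. [cite: ArakiMoriya2003, §4.1 Def. 4.1 (2) and Def. 4.5 (states of the quasi-local algebra)] -/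
theorem corr_smul_left {Λ X : Finset (Site d)} (c : ℂ) (A : FermionOp Λ) (C : FermionOp X) :
    ω.corr (c • A) C = c * ω.corr A C := by
  rw [corr_eq, corr_eq, map_smul, smul_mul_assoc, map_smul, smul_eq_mul]

/-- The two-point function is additive in the second observable. [cite: ArakiMoriya2003, §4.1 Def. 4.1 (2) and Def. 4.5 (states of the quasi-local algebra)] -/
theorem corr_add_right {Λ X : Finset (Site d)} (A : FermionOp Λ) (C C' : FermionOp X) :
    ω.corr A (C + C') = ω.corr A C + ω.corr A C' := by
  rw [corr_eq, corr_eq, corr_eq, map_add, mul_add, map_add]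

/-- The two-point function is homogeneous in the second observable. [cite: ArakiMoriya2003, §4.1 Def. 4.1 (2) and Def. 4.5 (states of the quasi-local algebra)] -/
theorem corr_smul_right {Λ X : Finset (Site d)} (c : ℂ) (A : FermionOp Λ) (C : FermionOp X) :
    ω.corr A (c • C) = c * ω.corr A C := by
  rw [corr_eq, corr_eq, map_smul, mul_smul_comm, map_smul, smul_eq_mul]

/-- The two-point function is subtractive in the second observable. [cite: ArakiMoriya2003, §4.1 Def. 4.1 (2) and Def. 4.5 (states of the quasi-local algebra)] -/
theorem corr_sub_right {Λ X : Finset (Site d)} (A : FermionOp Λ) (C C' : FermionOp X) :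
    ω.corr A (C - C') = ω.corr A C - ω.corr A C' := by
  rw [corr_eq, corr_eq, corr_eq, map_sub, mul_sub, map_sub]

/-- **Translation invariance on translated observables**: `ω(Γ(τ_z) B) = ω(B)` for a
translation-invariant `ω`. [cite: ArakiMoriya2003, §4.1 Def. 4.5] -/
theorem IsTranslationInvariant.expect_fermionEmbed_shiftEmb {ω : InfVolFermionState d}
    (hω : ω.IsTranslationInvariant) (z : Site d) (X : Finset (Site d)) (B : FermionOp X) :
    ω.expect (shiftSet z X) (fermionEmbed (PolySite.shiftEmb z X) B) = ω.expect X B := by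
  rw [← shift_expect, hω z]

/-- **Translation covariance of the two-point function, one leg translated**: for a
translation-invariant `ω`, `ω(Γ(τ_v) A · Γ(τ_z) B) = ω(A · Γ(τ_{z-v}) B)`.
[cite: ArakiMoriya2003, §4.1 eq. (4.12)] -/
theorem IsTranslationInvariant.corr_shiftEmb_left {ω : InfVolFermionState d}
    (hω : ω.IsTranslationInvariant) (v z : Site d) {Λ X : Finset (Site d)} (A : FermionOp Λ)
    (B : FermionOp X) :
    ω.corr (fermionEmbed (PolySite.shiftEmb v Λ) A) (fermionEmbed (PolySite.shiftEmb z X) B) =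
      ω.corr A (fermionEmbed (PolySite.shiftEmb (z - v) X) B) := by
  have hw : z = (z - v) + v := (sub_add_cancel z v).symm
  rw [← ω.corr_fermionEmbed_incl_right (shiftSet_subset_shiftSet_shiftSet hw X),
    ← fermionEmbed_shiftEmb_shiftEmb hw B, ← shift_corr, hω v]

end InfVolFermionState

/-- **Graded locality for embedded local observables**: an EVEN observable of a region `X`
(`Θ B = B`) commutes, inside any common region `Λ'`, with every observable of a region `Λ`
disjoint from `X`. [cite: BratteliRobinsonII1997, §5.2.2 (even elements of disjoint regions commute)] -/
theorem commute_fermionEmbed_incl_of_disjoint {X Λ Λ' : Finset (Site d)} {B : FermionOp X}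
    (hB : parityAut B = B) (hX : X ⊆ Λ') (hΛ : Λ ⊆ Λ') (hd : Disjoint X Λ) (A : FermionOp Λ) :
    Commute (fermionEmbed (PolySite.incl hX) B) (fermionEmbed (PolySite.incl hΛ) A) := by
  refine commute_fermionEmbed_of_mem_carEvenSubalgebra (PolySite.incl hΛ) A
    (fermionEmbed_mem_carEvenSubalgebra (PolySite.incl hX)
      (JordanWigner.mem_carEvenSubalgebra_univ_of_parityAut_eq hB)) ?_
  refine disjoint_orbs (Finset.disjoint_left.2 ?_)
  intro p hpX hpΛ
  rw [Finset.mem_map] at hpX hpΛ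
  obtain ⟨a, -, ha⟩ := hpX
  obtain ⟨b, -, hb⟩ := hpΛ
  have hab : a.1 = b.1 := by
    rw [← PolySite.coe_incl hX a, ← PolySite.coe_incl hΛ b, ha, hb]
  exact Finset.disjoint_left.1 hd (mem_lexSites.1 a.2) (hab ▸ mem_lexSites.1 b.2)

/-- `Θ` commutes with the translation maps: a translate of an even observable is even. [cite: ArakiMoriya2003, §4.1 Def. 4.3 (τ_k Θ = Θ τ_k)] -/
theorem parityAut_fermionEmbed_shiftEmb_of_parityAut_eq {X : Finset (Site d)} {B : FermionOp X}
    (hB : parityAut B = B) (z : Site d) :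
    parityAut (fermionEmbed (PolySite.shiftEmb z X) B) = fermionEmbed (PolySite.shiftEmb z X) B := by
  rw [← fermionEmbed_parityAut, hB]

section Norms

open scoped Matrix.Norms.L2Operator

/-- **`Γ(φ)` is norm-contractive** (a `*`-homomorphism of finite-dimensional C⋆-algebras; in fact
isometric, only `≤` is used): `‖Γ(φ) a‖ ≤ ‖a‖` in the L²-operator norms.
[cite: BratteliRobinsonII1997, §5.2.2] -/
theorem norm_fermionEmbed_le {Λ Λ' : Type*} [LinearOrder Λ] [Fintype Λ] [LinearOrder Λ']
    [Fintype Λ'] (φ : Λ ↪ Λ') (a : Matrix (Finset (Orb Λ)) (Finset (Orb Λ)) ℂ) :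
    ‖fermionEmbed φ a‖ ≤ ‖a‖ := by
  letI : CStarAlgebra (Matrix (Finset (Orb Λ)) (Finset (Orb Λ)) ℂ) := {}
  letI : CStarAlgebra (Matrix (Finset (Orb Λ')) (Finset (Orb Λ')) ℂ) := {}
  let ψ : Matrix (Finset (Orb Λ)) (Finset (Orb Λ)) ℂ →⋆ₐ[ℂ]
      Matrix (Finset (Orb Λ')) (Finset (Orb Λ')) ℂ :=
    { fermionEmbed φ with
      map_star' := fun x => by
        simp only [AlgHom.toRingHom_eq_coe, RingHom.toMonoidHom_eq_coe, OneHom.toFun_eq_coe,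
          MonoidHom.toOneHom_coe, MonoidHom.coe_coe, RingHom.coe_coe]
        rw [Matrix.star_eq_conjTranspose, Matrix.star_eq_conjTranspose, fermionEmbed_conjTranspose] }
  exact NonUnitalStarAlgHom.norm_apply_le ψ a

namespace InfVolFermionState

/-- `|ω(A · C)| ≤ ‖A‖ ‖C‖` (states are contractive, `Γ` is contractive, the norm is
submultiplicative). [cite: BratteliRobinsonI1987, Prop. 2.3.11] -/
theorem norm_corr_le (ω : InfVolFermionState d) {Λ X : Finset (Site d)} (A : FermionOp Λ)
    (C : FermionOp X) : ‖ω.corr A C‖ ≤ ‖A‖ * ‖C‖ := by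
  rw [corr_eq]
  refine (ω.norm_expect_le _ _).trans ((norm_mul_le _ _).trans ?_)
  exact mul_le_mul (norm_fermionEmbed_le _ _) (norm_fermionEmbed_le _ _) (norm_nonneg _)
    (norm_nonneg _)

/-- `|ω(A · Γ(τ_z) B)| ≤ ‖A‖ ‖B‖`, uniformly in the translation `z`. [cite: BratteliRobinsonI1987, Prop. 2.3.11] -/
theorem norm_corr_shiftEmb_le (ω : InfVolFermionState d) {Λ X : Finset (Site d)} (A : FermionOp Λ)
    (B : FermionOp X) (z : Site d) :
    ‖ω.corr A (fermionEmbed (PolySite.shiftEmb z X) B)‖ ≤ ‖A‖ * ‖B‖ :=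
  (ω.norm_corr_le A _).trans (mul_le_mul_of_nonneg_left (norm_fermionEmbed_le _ _) (norm_nonneg _))

end InfVolFermionState

end Norms

/-! ### §3. Ultrafilter limits of bounded sequences -/

/-- A bounded complex sequence converges along every ultrafilter (to its `limUnder`): closed balls
of `ℂ` are compact. [folklore] -/
private theorem tendsto_limUnder_of_norm_le {s : ℕ → ℂ} {R : ℝ} (𝒰 : Ultrafilter ℕ) (hs : ∀ n, ‖s n‖ ≤ R) :
    Tendsto s (𝒰 : Filter ℕ) (𝓝 (limUnder (𝒰 : Filter ℕ) s)) := by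
  refine tendsto_nhds_limUnder ?_
  have hle : (↑(Ultrafilter.map s 𝒰) : Filter ℂ) ≤ 𝓟 (Metric.closedBall (0 : ℂ) R) := by
    rw [Ultrafilter.coe_map, le_principal_iff]
    exact mem_map.2 (Filter.Eventually.of_forall fun n => by simpa using hs n)
  obtain ⟨x, -, hx⟩ := (isCompact_closedBall (0 : ℂ) R).ultrafilter_le_nhds _ hle
  exact ⟨x, by rwa [Ultrafilter.coe_map] at hx⟩

/-- Along an ultrafilter finer than `atTop`, a sequence converging in the usual sense has the same
`limUnder`. [folklore] -/
private theorem limUnder_eq_of_tendsto_atTop {s : ℕ → ℂ} {x : ℂ} (𝒰 : Ultrafilter ℕ)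
    (h𝒰 : (𝒰 : Filter ℕ) ≤ atTop) (hs : Tendsto s atTop (𝓝 x)) :
    limUnder (𝒰 : Filter ℕ) s = x :=
  (hs.mono_left h𝒰).limUnder_eq

/-! ### §4. The abstract extremality argument -/

namespace InfVolFermionState

/-- **Limit states along a free ultrafilter.** Let `φ_N` (`N ∈ ℕ`) be a family of local linear
functionals `φ_N,Λ : 𝔄_Λ → ℂ` which is bounded, compatible with isotony, eventually normalised to a
constant `m > 0` (`φ_N,Λ(𝟙) = m`), asymptotically positive (`φ_N,Λ(A⋆A) = p_N + o(1)` with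
`p_N ≥ 0`) and asymptotically translation invariant (`φ_N(τ_v A) - φ_N(A) → 0`). Then along every
ultrafilter `𝒰` finer than `atTop` the pointwise limits `m⁻¹ lim_𝒰 φ_N,Λ(A)` are the local
expectations of a translation-invariant infinite-volume STATE. (The GNS-free form of "the vector
functional of an `E_ω`-invariant vector is a `G`-invariant positive functional", Bratteli–Robinson I
§4.3.1–4.3.2.) [cite: BratteliRobinsonI1987, §4.3.1 (PDF p. 373)] -/
theorem exists_isTranslationInvariant_of_approximants
    (φ : ℕ → (Λ : Finset (Site d)) → FermionOp Λ → ℂ) (m : ℝ)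
    (hadd : ∀ N Λ (A A' : FermionOp Λ), φ N Λ (A + A') = φ N Λ A + φ N Λ A')
    (hsmul : ∀ N Λ (c : ℂ) (A : FermionOp Λ), φ N Λ (c • A) = c * φ N Λ A)
    (hbdd : ∀ Λ (A : FermionOp Λ), ∃ R : ℝ, ∀ N, ‖φ N Λ A‖ ≤ R)
    (hone : ∀ Λ, ∀ᶠ N in atTop, φ N Λ 1 = m)
    (hpos : ∀ Λ (A : FermionOp Λ), ∃ p : ℕ → ℂ, (∀ N, 0 ≤ p N) ∧
      Tendsto (fun N => φ N Λ (Aᴴ * A) - p N) atTop (𝓝 0))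
    (hcomp : ∀ N ⦃Λ Λ' : Finset (Site d)⦄ (h : Λ ⊆ Λ') (A : FermionOp Λ),
      φ N Λ' (fermionEmbed (PolySite.incl h) A) = φ N Λ A)
    (hTI : ∀ (v : Site d) Λ (A : FermionOp Λ),
      Tendsto (fun N => φ N (shiftSet v Λ) (fermionEmbed (PolySite.shiftEmb v Λ) A) - φ N Λ A)
        atTop (𝓝 0))
    (hm : 0 < m) (𝒰 : Ultrafilter ℕ) (h𝒰 : (𝒰 : Filter ℕ) ≤ atTop) :
    ∃ ψ : InfVolFermionState d, ψ.IsTranslationInvariant ∧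
      ∀ Λ (A : FermionOp Λ),
        ψ.expect Λ A = (m : ℂ)⁻¹ * limUnder (𝒰 : Filter ℕ) (fun N => φ N Λ A) := by
  -- every `φ_N,Λ(A)` converges along `𝒰`
  have hL : ∀ Λ (A : FermionOp Λ), Tendsto (fun N => φ N Λ A) (𝒰 : Filter ℕ)
      (𝓝 (limUnder (𝒰 : Filter ℕ) (fun N => φ N Λ A))) := fun Λ A => by
    obtain ⟨R, hR⟩ := hbdd Λ A
    exact tendsto_limUnder_of_norm_le 𝒰 hR
  have hm0 : (m : ℂ) ≠ 0 := Complex.ofReal_ne_zero.2 hm.ne'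
  -- the limit functionals
  have hLadd : ∀ Λ (A A' : FermionOp Λ), limUnder (𝒰 : Filter ℕ) (fun N => φ N Λ (A + A')) =
      limUnder (𝒰 : Filter ℕ) (fun N => φ N Λ A) + limUnder (𝒰 : Filter ℕ) (fun N => φ N Λ A') :=
    fun Λ A A' => by
      have h : Tendsto (fun N => φ N Λ (A + A')) (𝒰 : Filter ℕ)
          (𝓝 (limUnder (𝒰 : Filter ℕ) (fun N => φ N Λ A) +
            limUnder (𝒰 : Filter ℕ) (fun N => φ N Λ A'))) := by
        simp_rw [hadd]
        exact (hL Λ A).add (hL Λ A')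
      exact h.limUnder_eq
  have hLsmul : ∀ Λ (c : ℂ) (A : FermionOp Λ), limUnder (𝒰 : Filter ℕ) (fun N => φ N Λ (c • A)) =
      c * limUnder (𝒰 : Filter ℕ) (fun N => φ N Λ A) := fun Λ c A => by
    have h : Tendsto (fun N => φ N Λ (c • A)) (𝒰 : Filter ℕ)
        (𝓝 (c * limUnder (𝒰 : Filter ℕ) (fun N => φ N Λ A))) := by
      simp_rw [hsmul]
      exact (hL Λ A).const_mul c
    exact h.limUnder_eq
  have hLone : ∀ Λ, limUnder (𝒰 : Filter ℕ) (fun N => φ N Λ 1) = m := fun Λ =>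
    limUnder_eq_of_tendsto_atTop 𝒰 h𝒰
      (tendsto_const_nhds.congr' ((hone Λ).mono fun N hN => hN.symm))
  have hLnonneg : ∀ Λ (A : FermionOp Λ), 0 ≤ limUnder (𝒰 : Filter ℕ) (fun N => φ N Λ (Aᴴ * A)) :=
    fun Λ A => by
      obtain ⟨p, hp0, hp⟩ := hpos Λ A
      have h : Tendsto p (𝒰 : Filter ℕ) (𝓝 (limUnder (𝒰 : Filter ℕ) (fun N => φ N Λ (Aᴴ * A)))) := by
        have h1 := (hL Λ (Aᴴ * A)).sub (hp.mono_left h𝒰)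
        rw [sub_zero] at h1
        exact h1.congr fun N => by ring
      exact isClosed_Ici.mem_of_tendsto h (Filter.Eventually.of_forall hp0)
  have hLcomp : ∀ ⦃Λ Λ' : Finset (Site d)⦄ (h : Λ ⊆ Λ') (A : FermionOp Λ),
      limUnder (𝒰 : Filter ℕ) (fun N => φ N Λ' (fermionEmbed (PolySite.incl h) A)) =
        limUnder (𝒰 : Filter ℕ) (fun N => φ N Λ A) := fun Λ Λ' h A => by
    simp_rw [hcomp _ h]
  have hLTI : ∀ (v : Site d) Λ (A : FermionOp Λ),
      limUnder (𝒰 : Filter ℕ) (fun N => φ N (shiftSet v Λ) (fermionEmbed (PolySite.shiftEmb v Λ) A)) =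
        limUnder (𝒰 : Filter ℕ) (fun N => φ N Λ A) := fun v Λ A => by
    have h := (hL Λ A).add ((hTI v Λ A).mono_left h𝒰)
    rw [add_zero] at h
    exact (h.congr fun N => by ring).limUnder_eq
  refine ⟨{ expect := fun Λ =>
              { toFun := fun A => (m : ℂ)⁻¹ * limUnder (𝒰 : Filter ℕ) (fun N => φ N Λ A)
                map_add' := fun A A' => by rw [hLadd, mul_add]
                map_smul' := fun c A => by rw [hLsmul, RingHom.id_apply, smul_eq_mul]; ring }
            expect_one := fun Λ => by
              simp only [LinearMap.coe_mk, AddHom.coe_mk, hLone, inv_mul_cancel₀ hm0]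
            expect_nonneg := fun Λ A => by
              simp only [LinearMap.coe_mk, AddHom.coe_mk]
              rw [← Complex.ofReal_inv]
              exact mul_nonneg (Complex.zero_le_real.2 (inv_nonneg.2 hm.le)) (hLnonneg Λ A)
            compatible := fun Λ Λ' h A => by
              simp only [LinearMap.coe_mk, AddHom.coe_mk, hLcomp h] }, fun v => ?_, fun Λ A => rfl⟩
  refine InfVolFermionState.ext fun Λ => LinearMap.ext fun A => ?_
  rw [shift_expect]
  simp only [LinearMap.coe_mk, AddHom.coe_mk, hLTI]

/-- **Extremality forces the limit functionals to be multiples of `ω`.** If an ergodic `ω` is,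
eventually in `N`, the sum `φ¹_N + φ²_N` of two families whose ultrafilter limits are
`m₁`, `m₂` times translation-invariant states (`m₁, m₂ > 0`, `m₁ + m₂ = 1`), then
`lim_𝒰 φ¹_N,Λ(A) = m₁ ω(A)`: the two limit states give a convex decomposition of `ω` into invariant
states, and `ω` is extremal. Bratteli–Robinson I §4.3.1 (ergodic = extremal invariant), the
`(2) ⇒ (1)` mechanism of Thm. 4.3.17. [cite: BratteliRobinsonI1987, Thm. 4.3.17 (PDF p. 395)] -/
theorem IsErgodic.limUnder_eq_of_limitStates {ω : InfVolFermionState d} (herg : ω.IsErgodic)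
    {φ₁ φ₂ : ℕ → (Λ : Finset (Site d)) → FermionOp Λ → ℂ} {m₁ m₂ : ℝ} (hm₁ : 0 < m₁)
    (hm₂ : 0 < m₂) (hm : m₁ + m₂ = 1) {𝒰 : Ultrafilter ℕ} (h𝒰 : (𝒰 : Filter ℕ) ≤ atTop)
    (h₁ : ∃ ψ : InfVolFermionState d, ψ.IsTranslationInvariant ∧ ∀ Λ (A : FermionOp Λ),
      ψ.expect Λ A = (m₁ : ℂ)⁻¹ * limUnder (𝒰 : Filter ℕ) (fun N => φ₁ N Λ A))
    (h₂ : ∃ ψ : InfVolFermionState d, ψ.IsTranslationInvariant ∧ ∀ Λ (A : FermionOp Λ),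
      ψ.expect Λ A = (m₂ : ℂ)⁻¹ * limUnder (𝒰 : Filter ℕ) (fun N => φ₂ N Λ A))
    (hbdd₁ : ∀ Λ (A : FermionOp Λ), ∃ R : ℝ, ∀ N, ‖φ₁ N Λ A‖ ≤ R)
    (hbdd₂ : ∀ Λ (A : FermionOp Λ), ∃ R : ℝ, ∀ N, ‖φ₂ N Λ A‖ ≤ R)
    (hsum : ∀ Λ (A : FermionOp Λ), ∀ᶠ N in atTop, φ₁ N Λ A + φ₂ N Λ A = ω.expect Λ A)
    (Λ : Finset (Site d)) (A : FermionOp Λ) :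
    limUnder (𝒰 : Filter ℕ) (fun N => φ₁ N Λ A) = (m₁ : ℂ) * ω.expect Λ A := by
  obtain ⟨ψ₁, hψ₁, hψ₁e⟩ := h₁
  obtain ⟨ψ₂, hψ₂, hψ₂e⟩ := h₂
  have hm₁0 : (m₁ : ℂ) ≠ 0 := Complex.ofReal_ne_zero.2 hm₁.ne'
  have hm₂0 : (m₂ : ℂ) ≠ 0 := Complex.ofReal_ne_zero.2 hm₂.ne'
  -- the two limits sum to `ω`
  have hlimsum : ∀ Λ' (A' : FermionOp Λ'), limUnder (𝒰 : Filter ℕ) (fun N => φ₁ N Λ' A') +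
      limUnder (𝒰 : Filter ℕ) (fun N => φ₂ N Λ' A') = ω.expect Λ' A' := fun Λ' A' => by
    obtain ⟨R₁, hR₁⟩ := hbdd₁ Λ' A'
    obtain ⟨R₂, hR₂⟩ := hbdd₂ Λ' A'
    have ha := (tendsto_limUnder_of_norm_le 𝒰 hR₁).add (tendsto_limUnder_of_norm_le 𝒰 hR₂)
    have hb : Tendsto (fun N => φ₁ N Λ' A' + φ₂ N Λ' A') (𝒰 : Filter ℕ) (𝓝 (ω.expect Λ' A')) :=
      tendsto_const_nhds.congr' (((hsum Λ' A').filter_mono h𝒰).mono fun N hN => hN.symm)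
    exact tendsto_nhds_unique ha hb
  have hmix : mix m₁ hm₁.le (by linarith) ψ₁ ψ₂ = ω := by
    refine InfVolFermionState.ext fun Λ' => LinearMap.ext fun A' => ?_
    rw [mix_expect, hψ₁e, hψ₂e, ← hlimsum Λ' A', show (1 - m₁ : ℝ) = m₂ by linarith,
      mul_inv_cancel_left₀ hm₁0, mul_inv_cancel_left₀ hm₂0]
  have hψ₁ω : ψ₁ = ω := (herg.2 m₁ hm₁.le (by linarith) ψ₁ ψ₂ hm₁ (by linarith) hψ₁ hψ₂ hmix).1
  have h := hψ₁e Λ A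
  rw [hψ₁ω] at h
  calc limUnder (𝒰 : Filter ℕ) (fun N => φ₁ N Λ A)
      = (m₁ : ℂ) * ((m₁ : ℂ)⁻¹ * limUnder (𝒰 : Filter ℕ) (fun N => φ₁ N Λ A)) := by
        rw [mul_inv_cancel_left₀ hm₁0]
    _ = (m₁ : ℂ) * ω.expect Λ A := by rw [← h]

end InfVolFermionState

/-! ### §5. The Fejér (box-pair) functionals `Σ_{x,y ∈ [0,N)^d} ω(A · τ_{y-x} B)` -/

section PosSemidefEmbed

open scoped MatrixOrder

/-- `Γ(φ)` preserves positivity: the image of a positive semidefinite operator is positive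
semidefinite (`Γ` is a `*`-homomorphism; the cone is generated by the `s⋆ s`). [folklore] -/
private theorem posSemidef_fermionEmbed_local {Λ Λ' : Type*} [LinearOrder Λ] [Fintype Λ] [LinearOrder Λ']
    [Fintype Λ'] (φ : Λ ↪ Λ') {a : Matrix (Finset (Orb Λ)) (Finset (Orb Λ)) ℂ} (ha : a.PosSemidef) :
    (fermionEmbed φ a).PosSemidef := by
  rw [← Matrix.nonneg_iff_posSemidef] at ha ⊢
  rw [StarOrderedRing.nonneg_iff] at ha
  induction ha using AddSubmonoid.closure_induction with
  | mem x hx =>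
    obtain ⟨s, rfl⟩ := hx
    rw [map_mul, Matrix.star_eq_conjTranspose, fermionEmbed_conjTranspose]
    exact Matrix.nonneg_iff_posSemidef.2 (posSemidef_conjTranspose_mul_self _)
  | zero => simp
  | add x y _ _ hx hy =>
    rw [map_add]
    exact add_nonneg hx hy

end PosSemidefEmbed

namespace InfVolFermionState

section Fejer

open scoped Matrix.Norms.L2Operator

variable (ω : InfVolFermionState d) {Λ X : Finset (Site d)}

/-- Additivity of the box-pair sums in the first observable. [folklore] -/
private theorem boxPairSum_add_left (N : ℕ) (A A' : FermionOp Λ) (B : FermionOp X) :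
    ∑ x ∈ halfOpenBox d N, ∑ y ∈ halfOpenBox d N,
        ω.corr (A + A') (fermionEmbed (PolySite.shiftEmb (y - x) X) B) =
      ∑ x ∈ halfOpenBox d N, ∑ y ∈ halfOpenBox d N,
          ω.corr A (fermionEmbed (PolySite.shiftEmb (y - x) X) B) +
        ∑ x ∈ halfOpenBox d N, ∑ y ∈ halfOpenBox d N,
          ω.corr A' (fermionEmbed (PolySite.shiftEmb (y - x) X) B) := by
  simp_rw [corr_add_left, sum_add_distrib]

/-- Homogeneity of the box-pair sums in the first observable. [folklore] -/
private theorem boxPairSum_smul_left (N : ℕ) (c : ℂ) (A : FermionOp Λ) (B : FermionOp X) :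
    ∑ x ∈ halfOpenBox d N, ∑ y ∈ halfOpenBox d N,
        ω.corr (c • A) (fermionEmbed (PolySite.shiftEmb (y - x) X) B) =
      c * ∑ x ∈ halfOpenBox d N, ∑ y ∈ halfOpenBox d N,
        ω.corr A (fermionEmbed (PolySite.shiftEmb (y - x) X) B) := by
  simp_rw [corr_smul_left, mul_sum]

/-- Additivity of the box-pair sums in the translated observable. [folklore] -/
private theorem boxPairSum_add_right (N : ℕ) (A : FermionOp Λ) (B B' : FermionOp X) :
    ∑ x ∈ halfOpenBox d N, ∑ y ∈ halfOpenBox d N,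
        ω.corr A (fermionEmbed (PolySite.shiftEmb (y - x) X) (B + B')) =
      ∑ x ∈ halfOpenBox d N, ∑ y ∈ halfOpenBox d N,
          ω.corr A (fermionEmbed (PolySite.shiftEmb (y - x) X) B) +
        ∑ x ∈ halfOpenBox d N, ∑ y ∈ halfOpenBox d N,
          ω.corr A (fermionEmbed (PolySite.shiftEmb (y - x) X) B') := by
  simp_rw [map_add, corr_add_right, sum_add_distrib]

/-- Subtractivity of the box-pair sums in the translated observable. [folklore] -/
private theorem boxPairSum_sub_right (N : ℕ) (A : FermionOp Λ) (B B' : FermionOp X) :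
    ∑ x ∈ halfOpenBox d N, ∑ y ∈ halfOpenBox d N,
        ω.corr A (fermionEmbed (PolySite.shiftEmb (y - x) X) (B - B')) =
      ∑ x ∈ halfOpenBox d N, ∑ y ∈ halfOpenBox d N,
          ω.corr A (fermionEmbed (PolySite.shiftEmb (y - x) X) B) -
        ∑ x ∈ halfOpenBox d N, ∑ y ∈ halfOpenBox d N,
          ω.corr A (fermionEmbed (PolySite.shiftEmb (y - x) X) B') := by
  simp_rw [map_sub, corr_sub_right, sum_sub_distrib]

/-- Homogeneity of the box-pair sums in the translated observable. [folklore] -/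
private theorem boxPairSum_smul_right (N : ℕ) (c : ℂ) (A : FermionOp Λ) (B : FermionOp X) :
    ∑ x ∈ halfOpenBox d N, ∑ y ∈ halfOpenBox d N,
        ω.corr A (fermionEmbed (PolySite.shiftEmb (y - x) X) (c • B)) =
      c * ∑ x ∈ halfOpenBox d N, ∑ y ∈ halfOpenBox d N,
        ω.corr A (fermionEmbed (PolySite.shiftEmb (y - x) X) B) := by
  simp_rw [map_smul, corr_smul_right, mul_sum]

/-- The box-pair sums against the unit: `Σ_{x,y} ω(A · τ_{y-x} 𝟙) = N^{2d} ω(A)`. [folklore] -/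
private theorem boxPairSum_one_right (N : ℕ) (A : FermionOp Λ) :
    ∑ x ∈ halfOpenBox d N, ∑ y ∈ halfOpenBox d N,
        ω.corr A (fermionEmbed (PolySite.shiftEmb (y - x) X) (1 : FermionOp X)) =
      ((N : ℂ) ^ d) ^ 2 * ω.expect Λ A := by
  simp_rw [map_one, corr_one_right, sum_const, card_halfOpenBox, nsmul_eq_mul]
  push_cast
  ring

/-- The box-pair sums of a translation-invariant state on the unit observable:
`Σ_{x,y} ω(𝟙 · τ_{y-x} B) = N^{2d} ω(B)`. [cite: ArakiMoriya2003, §4.1 Def. 4.5] -/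
theorem IsTranslationInvariant.boxPairSum_one_left {ω : InfVolFermionState d}
    (hω : ω.IsTranslationInvariant) (N : ℕ) (B : FermionOp X) :
    ∑ x ∈ halfOpenBox d N, ∑ y ∈ halfOpenBox d N,
        ω.corr (1 : FermionOp Λ) (fermionEmbed (PolySite.shiftEmb (y - x) X) B) =
      ((N : ℂ) ^ d) ^ 2 * ω.expect X B := by
  simp_rw [corr_one_left, hω.expect_fermionEmbed_shiftEmb, sum_const, card_halfOpenBox,
    nsmul_eq_mul]
  push_cast
  ring

/-- Compatibility of the box-pair sums with isotony in the first observable. [folklore] -/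
private theorem boxPairSum_fermionEmbed_incl_left (N : ℕ) {Λ' : Finset (Site d)} (h : Λ ⊆ Λ')
    (A : FermionOp Λ) (B : FermionOp X) :
    ∑ x ∈ halfOpenBox d N, ∑ y ∈ halfOpenBox d N,
        ω.corr (fermionEmbed (PolySite.incl h) A) (fermionEmbed (PolySite.shiftEmb (y - x) X) B) =
      ∑ x ∈ halfOpenBox d N, ∑ y ∈ halfOpenBox d N,
        ω.corr A (fermionEmbed (PolySite.shiftEmb (y - x) X) B) := by
  simp_rw [corr_fermionEmbed_incl_left]

/-- The box-pair sums are bounded by `N^{2d} ‖A‖ ‖B‖`. [cite: BratteliRobinsonI1987, Prop. 2.3.11] -/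
theorem norm_boxPairSum_le (N : ℕ) (A : FermionOp Λ) (B : FermionOp X) :
    ‖∑ x ∈ halfOpenBox d N, ∑ y ∈ halfOpenBox d N,
        ω.corr A (fermionEmbed (PolySite.shiftEmb (y - x) X) B)‖ ≤
      ((N : ℝ) ^ d) ^ 2 * (‖A‖ * ‖B‖) := by
  calc ‖∑ x ∈ halfOpenBox d N, ∑ y ∈ halfOpenBox d N,
          ω.corr A (fermionEmbed (PolySite.shiftEmb (y - x) X) B)‖
      ≤ ∑ x ∈ halfOpenBox d N, ‖∑ y ∈ halfOpenBox d N,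
          ω.corr A (fermionEmbed (PolySite.shiftEmb (y - x) X) B)‖ := norm_sum_le _ _
    _ ≤ ∑ x ∈ halfOpenBox d N, ∑ y ∈ halfOpenBox d N, ‖A‖ * ‖B‖ :=
        sum_le_sum fun x _ => (norm_sum_le _ _).trans
          (sum_le_sum fun y _ => ω.norm_corr_shiftEmb_le A B (y - x))
    _ = ((N : ℝ) ^ d) ^ 2 * (‖A‖ * ‖B‖) := by
        rw [sum_const, sum_const, card_halfOpenBox, smul_smul, nsmul_eq_mul]
        push_cast
        ring

/-- Normalised form: `|N^{-2d} Σ_{x,y} ω(A · τ_{y-x} B)| ≤ ‖A‖ ‖B‖`. [cite: BratteliRobinsonI1987, Prop. 2.3.11] -/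
theorem norm_boxPairAverage_le (N : ℕ) (A : FermionOp Λ) (B : FermionOp X) :
    ‖(((N : ℂ) ^ d) ^ 2)⁻¹ * ∑ x ∈ halfOpenBox d N, ∑ y ∈ halfOpenBox d N,
        ω.corr A (fermionEmbed (PolySite.shiftEmb (y - x) X) B)‖ ≤ ‖A‖ * ‖B‖ := by
  have h := ω.norm_boxPairSum_le N A B
  rw [norm_mul, norm_inv, norm_pow, norm_pow, Complex.norm_natCast]
  rcases eq_or_lt_of_le (pow_nonneg (pow_nonneg (Nat.cast_nonneg N) d) 2 :
      (0 : ℝ) ≤ ((N : ℝ) ^ d) ^ 2) with h0 | h0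
  · rw [← h0, _root_.inv_zero, zero_mul]
    exact mul_nonneg (norm_nonneg _) (norm_nonneg _)
  · rw [inv_mul_le_iff₀ h0]
    exact h

/-- **The translation defect of the box-pair sums.** For a translation-invariant `ω`,
`|Σ_{x,y} ω(τ_v A · τ_{y-x} B) - Σ_{x,y} ω(A · τ_{y-x} B)| ≤ N^d · 2 |v|₁ N^{d-1} · ‖A‖ ‖B‖`:
by translation covariance the first sum is `Σ_x Σ_{y ∈ [0,N)^d - v} ω(A · τ_{y-x} B)`, and the
boxes are Følner (§1). [cite: BratteliRobinsonI1987, Prop. 4.3.4 (Følner averages for ℤ^d)] -/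
theorem IsTranslationInvariant.norm_boxPairSum_shift_sub_le {ω : InfVolFermionState d}
    (hω : ω.IsTranslationInvariant) (v : Site d) (N : ℕ) (A : FermionOp Λ) (B : FermionOp X) :
    ‖∑ x ∈ halfOpenBox d N, ∑ y ∈ halfOpenBox d N,
        ω.corr (fermionEmbed (PolySite.shiftEmb v Λ) A)
          (fermionEmbed (PolySite.shiftEmb (y - x) X) B) -
      ∑ x ∈ halfOpenBox d N, ∑ y ∈ halfOpenBox d N,
        ω.corr A (fermionEmbed (PolySite.shiftEmb (y - x) X) B)‖ ≤
      (N : ℝ) ^ d * (2 * (((∑ i, (v i).natAbs) * N ^ (d - 1) : ℕ) : ℝ) * (‖A‖ * ‖B‖)) := by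
  classical
  simp_rw [hω.corr_shiftEmb_left]
  rw [← sum_sub_distrib]
  refine (norm_sum_le _ _).trans ?_
  have hx : ∀ x ∈ halfOpenBox d N,
      ‖∑ y ∈ halfOpenBox d N, ω.corr A (fermionEmbed (PolySite.shiftEmb (y - x - v) X) B) -
        ∑ y ∈ halfOpenBox d N, ω.corr A (fermionEmbed (PolySite.shiftEmb (y - x) X) B)‖ ≤
        2 * (((∑ i, (v i).natAbs) * N ^ (d - 1) : ℕ) : ℝ) * (‖A‖ * ‖B‖) := by
    intro x _
    -- the translated inner sum is a sum over the translated box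
    have hmap : ∑ y ∈ halfOpenBox d N, ω.corr A (fermionEmbed (PolySite.shiftEmb (y - x - v) X) B) =
        ∑ y ∈ shiftSet (-v) (halfOpenBox d N),
          ω.corr A (fermionEmbed (PolySite.shiftEmb (y - x) X) B) := by
      rw [shiftSet_eq_map, sum_map]
      refine sum_congr rfl fun y _ => ?_
      have e : y - x - v = (Site.shift (-v)).toEmbedding y - x := by
        change y - x - v = y + -v - x
        abel
      rw [e]
    rw [hmap, ← sum_sdiff_sub_sum_sdiff]
    set S₁ := shiftSet (-v) (halfOpenBox d N) with hS₁
    set S₂ := halfOpenBox d N with hS₂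
    have hcard : #(S₁ \ S₂) = #(S₂ \ S₁) :=
      card_sdiff_comm (by rw [hS₁, shiftSet_eq_map, card_map])
    have hK : #(S₂ \ S₁) ≤ (∑ i, (v i).natAbs) * N ^ (d - 1) := card_halfOpenBox_sdiff_shiftSet_le N v
    have hb : ∀ (T : Finset (Site d)),
        ‖∑ y ∈ T, ω.corr A (fermionEmbed (PolySite.shiftEmb (y - x) X) B)‖ ≤ #T * (‖A‖ * ‖B‖) :=
      fun T => (norm_sum_le _ _).trans (by
        rw [← nsmul_eq_mul, ← sum_const]
        exact sum_le_sum fun y _ => ω.norm_corr_shiftEmb_le A B (y - x))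
    calc ‖∑ y ∈ S₁ \ S₂, ω.corr A (fermionEmbed (PolySite.shiftEmb (y - x) X) B) -
          ∑ y ∈ S₂ \ S₁, ω.corr A (fermionEmbed (PolySite.shiftEmb (y - x) X) B)‖
        ≤ #(S₁ \ S₂) * (‖A‖ * ‖B‖) + #(S₂ \ S₁) * (‖A‖ * ‖B‖) :=
          (norm_sub_le _ _).trans (add_le_add (hb _) (hb _))
      _ = 2 * (#(S₂ \ S₁) : ℝ) * (‖A‖ * ‖B‖) := by rw [hcard]; ring
      _ ≤ 2 * (((∑ i, (v i).natAbs) * N ^ (d - 1) : ℕ) : ℝ) * (‖A‖ * ‖B‖) := by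
          gcongr
  refine (sum_le_sum hx).trans ?_
  rw [sum_const, card_halfOpenBox, nsmul_eq_mul]
  push_cast
  rfl

/-- The displacements `z` for which `X + z` meets `Λ` lie in `Λ - X`; hence, for fixed `x`, at most
`|Λ| |X|` points `y` of any set have `X + (y - x)` meeting `Λ`. [folklore] -/
private theorem card_filter_not_disjoint_shiftSet_le (Λ X T : Finset (Site d)) (x : Site d) :
    #{y ∈ T | ¬ Disjoint (shiftSet (y - x) X) Λ} ≤ #Λ * #X := by
  classical
  calc #{y ∈ T | ¬ Disjoint (shiftSet (y - x) X) Λ}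
      ≤ #((Λ ×ˢ X).image fun p => p.1 - p.2 + x) := by
        refine card_le_card fun y hy => ?_
        rw [mem_filter] at hy
        obtain ⟨a, haX, haΛ⟩ := not_disjoint_iff.1 hy.2
        rw [mem_shiftSet] at haX
        exact mem_image.2 ⟨(a, a - (y - x)), mem_product.2 ⟨haΛ, haX⟩, by
          show a - (a - (y - x)) + x = y
          abel⟩
    _ ≤ #(Λ ×ˢ X) := card_image_le
    _ = #Λ * #X := card_product _ _

open scoped MatrixOrder in
/-- **The far part of the box-pair sum on `A⋆A` is nonnegative.** For `B ⪰ 0` EVEN, every pair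
`(x, y)` with `X + (y - x)` disjoint from `Λ` contributes
`ω((ΓA)⋆ ΓA · Γτ_{y-x}B) = ω((ΓA)⋆ · Γτ_{y-x}B · ΓA) ≥ 0` (graded locality: the even `τ_{y-x} B`
commutes with `A`). [cite: BratteliRobinsonII1997, §5.2.2] -/
theorem boxPairSum_far_nonneg {B : FermionOp X} (hB : parityAut B = B) (hB0 : B.PosSemidef)
    (N : ℕ) (A : FermionOp Λ) :
    0 ≤ ∑ x ∈ halfOpenBox d N, ∑ y ∈ halfOpenBox d N with Disjoint (shiftSet (y - x) X) Λ,
        ω.corr (Aᴴ * A) (fermionEmbed (PolySite.shiftEmb (y - x) X) B) := by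
  classical
  refine sum_nonneg fun x _ => sum_nonneg fun y hy => ?_
  rw [mem_filter] at hy
  rw [corr_eq, fermionEmbed_mul, fermionEmbed_conjTranspose]
  have hc := commute_fermionEmbed_incl_of_disjoint
    (parityAut_fermionEmbed_shiftEmb_of_parityAut_eq hB (y - x))
    (Finset.subset_union_right (s₁ := Λ)) Finset.subset_union_left hy.2 A
  rw [mul_assoc, ← hc.eq, ← mul_assoc]
  exact ω.expect_nonneg_of_nonneg _ (Matrix.nonneg_iff_posSemidef.2
    ((posSemidef_fermionEmbed_local _ (posSemidef_fermionEmbed_local _ hB0)).conjTranspose_mul_mul_same _))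

/-- **The positivity defect of the box-pair sums**: the near part (pairs with `X + (y - x)`
meeting `Λ`, at most `|Λ| |X|` per `x`) is `O(N^d)`:
`|Σ_{x,y} ω(A⋆A · τ_{y-x}B) - (far part)| ≤ N^d |Λ| |X| ‖A⋆A‖ ‖B‖`.
[cite: BratteliRobinsonII1997, §5.2.2] -/
theorem norm_boxPairSum_sub_far_le (N : ℕ) (A : FermionOp Λ) (B : FermionOp X) :
    ‖∑ x ∈ halfOpenBox d N, ∑ y ∈ halfOpenBox d N,
        ω.corr (Aᴴ * A) (fermionEmbed (PolySite.shiftEmb (y - x) X) B) -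
      ∑ x ∈ halfOpenBox d N, ∑ y ∈ halfOpenBox d N with Disjoint (shiftSet (y - x) X) Λ,
        ω.corr (Aᴴ * A) (fermionEmbed (PolySite.shiftEmb (y - x) X) B)‖ ≤
      (N : ℝ) ^ d * ((#Λ * #X : ℕ) * (‖Aᴴ * A‖ * ‖B‖)) := by
  classical
  have hsplit : ∀ x ∈ halfOpenBox d N,
      ∑ y ∈ halfOpenBox d N, ω.corr (Aᴴ * A) (fermionEmbed (PolySite.shiftEmb (y - x) X) B) -
        ∑ y ∈ halfOpenBox d N with Disjoint (shiftSet (y - x) X) Λ,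
          ω.corr (Aᴴ * A) (fermionEmbed (PolySite.shiftEmb (y - x) X) B) =
        ∑ y ∈ halfOpenBox d N with ¬ Disjoint (shiftSet (y - x) X) Λ,
          ω.corr (Aᴴ * A) (fermionEmbed (PolySite.shiftEmb (y - x) X) B) := by
    intro x _
    rw [← sum_filter_add_sum_filter_not (halfOpenBox d N) (fun y => Disjoint (shiftSet (y - x) X) Λ),
      add_sub_cancel_left]
  rw [← sum_sub_distrib, sum_congr rfl hsplit]
  refine (norm_sum_le _ _).trans ?_
  have hx : ∀ x ∈ halfOpenBox d N,
      ‖∑ y ∈ halfOpenBox d N with ¬ Disjoint (shiftSet (y - x) X) Λ,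
          ω.corr (Aᴴ * A) (fermionEmbed (PolySite.shiftEmb (y - x) X) B)‖ ≤
        (#Λ * #X : ℕ) * (‖Aᴴ * A‖ * ‖B‖) := by
    intro x _
    refine (norm_sum_le _ _).trans ?_
    refine (sum_le_sum fun y _ => ω.norm_corr_shiftEmb_le (Aᴴ * A) B (y - x)).trans ?_
    rw [sum_const, nsmul_eq_mul]
    exact mul_le_mul_of_nonneg_right (by exact_mod_cast card_filter_not_disjoint_shiftSet_le Λ X _ x)
      (mul_nonneg (norm_nonneg _) (norm_nonneg _))
  refine (sum_le_sum hx).trans ?_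
  rw [sum_const, card_halfOpenBox, nsmul_eq_mul]
  push_cast
  rfl

end Fejer

end InfVolFermionState

/-! ### §6. Ergodic states are weakly mixing in mean (Bratteli–Robinson I Thm. 4.3.17 + 4.3.22) -/

section LoewnerNorm

open scoped MatrixOrder Matrix.Norms.L2Operator

variable {n : Type*} [Fintype n] [DecidableEq n]

/-- `K ≤ ‖K‖·𝟙` for a Hermitian matrix (Loewner order, L²-operator norm): a self-adjoint element of
a C⋆-algebra is dominated by its norm. [folklore] -/
private theorem posSemidef_norm_smul_one_sub_of_isHermitian {K : Matrix n n ℂ} (hK : K.IsHermitian) :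
    ((‖K‖ : ℂ) • (1 : Matrix n n ℂ) - K).PosSemidef := by
  letI : CStarAlgebra (Matrix n n ℂ) := {}
  have hsa : IsSelfAdjoint K := hK
  have h := IsSelfAdjoint.le_algebraMap_norm_self hsa
  rw [Algebra.algebraMap_eq_smul_one] at h
  rw [← Matrix.nonneg_iff_posSemidef, sub_nonneg]
  convert h using 1
  ext i j
  simp [Matrix.smul_apply, Matrix.one_apply]

/-- `-‖K‖·𝟙 ≤ K` for a Hermitian matrix (Loewner order, L²-operator norm). [folklore] -/
private theorem posSemidef_norm_smul_one_add_of_isHermitian {K : Matrix n n ℂ} (hK : K.IsHermitian) :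
    ((‖K‖ : ℂ) • (1 : Matrix n n ℂ) + K).PosSemidef := by
  letI : CStarAlgebra (Matrix n n ℂ) := {}
  have hsa : IsSelfAdjoint K := hK
  have h := IsSelfAdjoint.neg_algebraMap_norm_le_self hsa
  rw [Algebra.algebraMap_eq_smul_one] at h
  rw [← Matrix.nonneg_iff_posSemidef, ← sub_nonneg] at *
  convert h using 1
  rw [sub_neg_eq_add, add_comm]
  ext i j
  simp [Matrix.smul_apply, Matrix.one_apply]

end LoewnerNorm

/-- A real scalar is self-adjoint in `ℂ`. [folklore] -/
private theorem isSelfAdjoint_real_toComplex (r : ℝ) : IsSelfAdjoint (r : ℂ) := by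
  rw [IsSelfAdjoint, Complex.star_def, Complex.conj_ofReal]

/-- Auxiliary arithmetic: `(N^d)⁻¹ N^{d-1} = N⁻¹` for `d ≥ 1`, `N ≥ 1`. [folklore] -/
private theorem inv_pow_mul_pow_pred_eq_inv (hd : 0 < d) {N : ℕ} (hN : N ≠ 0) :
    ((N : ℝ) ^ d)⁻¹ * (N : ℝ) ^ (d - 1) = ((N : ℝ))⁻¹ := by
  obtain ⟨k, rfl⟩ : ∃ k, d = k + 1 := ⟨d - 1, by omega⟩
  have hN' : (N : ℝ) ≠ 0 := Nat.cast_ne_zero.2 hN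
  rw [Nat.add_sub_cancel, pow_succ, _root_.mul_inv_rev, mul_assoc, inv_mul_cancel₀ (pow_ne_zero _ hN'),
    mul_one]

namespace InfVolFermionState

section Cluster

open scoped Matrix.Norms.L2Operator

variable {ω : InfVolFermionState d}

/-- The cast of the normalisation `(N^d)^{-2}` is a nonnegative real. [folklore] -/
private theorem boxPairAverage_weight_eq (N : ℕ) :
    ((((N : ℂ) ^ d) ^ 2)⁻¹ : ℂ) = (((((N : ℝ) ^ d) ^ 2)⁻¹ : ℝ) : ℂ) := by
  push_cast
  rfl

/-- **The Fejér functionals of a translation-invariant state have translation-invariant limit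
STATES** (for `B ⪰ 0` even with `ω(B) = m > 0`): the hypotheses of
`exists_isTranslationInvariant_of_approximants` are met by
`φ_N,Λ(A) = N^{-2d} Σ_{x,y ∈ [0,N)^d} ω(A · τ_{y-x} B)` (§5). [cite: BratteliRobinsonI1987, Thm. 4.3.17 (PDF p. 395)] -/
theorem IsTranslationInvariant.exists_limitState_boxPairAverage (hω : ω.IsTranslationInvariant)
    (hd : 0 < d) {X : Finset (Site d)} {B : FermionOp X} (hB : parityAut B = B)
    (hB0 : B.PosSemidef) {m : ℝ} (hm : 0 < m) (hmB : ω.expect X B = m) (𝒰 : Ultrafilter ℕ)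
    (h𝒰 : (𝒰 : Filter ℕ) ≤ atTop) :
    ∃ ψ : InfVolFermionState d, ψ.IsTranslationInvariant ∧ ∀ Λ (A : FermionOp Λ),
      ψ.expect Λ A = (m : ℂ)⁻¹ * limUnder (𝒰 : Filter ℕ) (fun N => (((N : ℂ) ^ d) ^ 2)⁻¹ *
        ∑ x ∈ halfOpenBox d N, ∑ y ∈ halfOpenBox d N,
          ω.corr A (fermionEmbed (PolySite.shiftEmb (y - x) X) B)) := by
  classical
  refine exists_isTranslationInvariant_of_approximants (fun N Λ A => (((N : ℂ) ^ d) ^ 2)⁻¹ *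
      ∑ x ∈ halfOpenBox d N, ∑ y ∈ halfOpenBox d N,
        ω.corr A (fermionEmbed (PolySite.shiftEmb (y - x) X) B)) m
    ?_ ?_ ?_ ?_ ?_ ?_ ?_ hm 𝒰 h𝒰
  · intro N Λ A A'
    rw [boxPairSum_add_left, mul_add]
  · intro N Λ c A
    rw [boxPairSum_smul_left]
    ring
  · exact fun Λ A => ⟨‖A‖ * ‖B‖, fun N => ω.norm_boxPairAverage_le N A B⟩
  · intro Λ
    filter_upwards [eventually_ne_atTop 0] with N hN
    have hc : ((N : ℂ) ^ d) ^ 2 ≠ 0 := pow_ne_zero _ (pow_ne_zero _ (Nat.cast_ne_zero.2 hN))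
    rw [hω.boxPairSum_one_left, ← mul_assoc, inv_mul_cancel₀ hc, one_mul, hmB]
  · intro Λ A
    refine ⟨fun N => (((N : ℂ) ^ d) ^ 2)⁻¹ *
        ∑ x ∈ halfOpenBox d N, ∑ y ∈ halfOpenBox d N with Disjoint (shiftSet (y - x) X) Λ,
          ω.corr (Aᴴ * A) (fermionEmbed (PolySite.shiftEmb (y - x) X) B), fun N => ?_, ?_⟩
    · beta_reduce
      rw [boxPairAverage_weight_eq]
      exact mul_nonneg (Complex.zero_le_real.2 (by positivity))
        (ω.boxPairSum_far_nonneg hB hB0 N A)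
    · have hK : Tendsto (fun N : ℕ => ((#Λ * #X : ℕ) * (‖Aᴴ * A‖ * ‖B‖) : ℝ) / N) atTop (𝓝 0) :=
        tendsto_const_div_atTop_nhds_zero_nat _
      refine squeeze_zero_norm' ?_ hK
      filter_upwards [eventually_ge_atTop 1] with N hN
      have hN0 : N ≠ 0 := by omega
      have hNr : (1 : ℝ) ≤ N := by exact_mod_cast hN
      rw [← mul_sub, norm_mul, boxPairAverage_weight_eq, Complex.norm_real, Real.norm_eq_abs,
        abs_of_nonneg (by positivity)]
      calc (((N : ℝ) ^ d) ^ 2)⁻¹ * ‖∑ x ∈ halfOpenBox d N, ∑ y ∈ halfOpenBox d N,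
              ω.corr (Aᴴ * A) (fermionEmbed (PolySite.shiftEmb (y - x) X) B) -
            ∑ x ∈ halfOpenBox d N, ∑ y ∈ halfOpenBox d N with Disjoint (shiftSet (y - x) X) Λ,
              ω.corr (Aᴴ * A) (fermionEmbed (PolySite.shiftEmb (y - x) X) B)‖
          ≤ (((N : ℝ) ^ d) ^ 2)⁻¹ * ((N : ℝ) ^ d * ((#Λ * #X : ℕ) * (‖Aᴴ * A‖ * ‖B‖))) :=
            mul_le_mul_of_nonneg_left (ω.norm_boxPairSum_sub_far_le N A B) (by positivity)
        _ = ((#Λ * #X : ℕ) * (‖Aᴴ * A‖ * ‖B‖) : ℝ) / (N : ℝ) ^ d := by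
            have hNd : (N : ℝ) ^ d ≠ 0 := pow_ne_zero _ (Nat.cast_ne_zero.2 hN0)
            field_simp
        _ ≤ ((#Λ * #X : ℕ) * (‖Aᴴ * A‖ * ‖B‖) : ℝ) / N :=
            div_le_div_of_nonneg_left (by positivity) (by positivity) (le_self_pow₀ hNr hd.ne')
  · intro N Λ Λ' h A
    rw [boxPairSum_fermionEmbed_incl_left]
  · intro v Λ A
    have hK : Tendsto (fun N : ℕ => (2 * (∑ i, (v i).natAbs : ℕ) * (‖A‖ * ‖B‖) : ℝ) / N) atTop
        (𝓝 0) := tendsto_const_div_atTop_nhds_zero_nat _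
    refine squeeze_zero_norm' ?_ hK
    filter_upwards [eventually_ge_atTop 1] with N hN
    have hN0 : N ≠ 0 := by omega
    rw [← mul_sub, norm_mul, boxPairAverage_weight_eq, Complex.norm_real, Real.norm_eq_abs,
      abs_of_nonneg (by positivity)]
    calc (((N : ℝ) ^ d) ^ 2)⁻¹ * ‖∑ x ∈ halfOpenBox d N, ∑ y ∈ halfOpenBox d N,
            ω.corr (fermionEmbed (PolySite.shiftEmb v Λ) A)
              (fermionEmbed (PolySite.shiftEmb (y - x) X) B) -
          ∑ x ∈ halfOpenBox d N, ∑ y ∈ halfOpenBox d N,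
            ω.corr A (fermionEmbed (PolySite.shiftEmb (y - x) X) B)‖
        ≤ (((N : ℝ) ^ d) ^ 2)⁻¹ * ((N : ℝ) ^ d *
            (2 * (((∑ i, (v i).natAbs) * N ^ (d - 1) : ℕ) : ℝ) * (‖A‖ * ‖B‖))) :=
          mul_le_mul_of_nonneg_left (hω.norm_boxPairSum_shift_sub_le v N A B) (by positivity)
      _ = (2 * (∑ i, (v i).natAbs : ℕ) * (‖A‖ * ‖B‖) : ℝ) *
            (((N : ℝ) ^ d)⁻¹ * (N : ℝ) ^ (d - 1)) := by
          have hNd : (N : ℝ) ^ d ≠ 0 := pow_ne_zero _ (Nat.cast_ne_zero.2 hN0)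
          push_cast
          field_simp
      _ = (2 * (∑ i, (v i).natAbs : ℕ) * (‖A‖ * ‖B‖) : ℝ) / N := by
          rw [inv_pow_mul_pow_pred_eq_inv hd hN0, div_eq_mul_inv]

/-- **The order-restricted core, along an ultrafilter**: for `ω` ergodic and an even `B` with
`0 ⪯ B ⪯ 𝟙`, `0 < ω(B) < 1`, `lim_𝒰 N^{-2d} Σ_{x,y} ω(A · τ_{y-x} B) = ω(B) ω(A)` — the Fejér
functionals of `B` and `𝟙 - B` have translation-invariant limit states that decompose `ω`
convexly, and `ω` is extremal. [cite: BratteliRobinsonI1987, Thm. 4.3.17 (PDF p. 395)] -/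
theorem IsErgodic.limUnder_boxPairAverage_eq_of_posSemidef (herg : ω.IsErgodic) (hd : 0 < d)
    {X : Finset (Site d)} {B : FermionOp X} (hB : parityAut B = B) (hB0 : B.PosSemidef)
    (hB1 : (1 - B).PosSemidef) (hω0 : 0 < (ω.expect X B).re) (hω1 : (ω.expect X B).re < 1)
    {𝒰 : Ultrafilter ℕ} (h𝒰 : (𝒰 : Filter ℕ) ≤ atTop) (Λ : Finset (Site d)) (A : FermionOp Λ) :
    limUnder (𝒰 : Filter ℕ) (fun N => (((N : ℂ) ^ d) ^ 2)⁻¹ *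
        ∑ x ∈ halfOpenBox d N, ∑ y ∈ halfOpenBox d N,
          ω.corr A (fermionEmbed (PolySite.shiftEmb (y - x) X) B)) =
      ω.expect X B * ω.expect Λ A := by
  classical
  have hω := herg.isTranslationInvariant
  set m₁ : ℝ := (ω.expect X B).re with hm₁
  have hmB : ω.expect X B = (m₁ : ℂ) :=
    Complex.ext (by rw [Complex.ofReal_re]) (by
      rw [Complex.ofReal_im]; exact ω.expect_im_eq_zero_of_isHermitian hB0.1)
  have hB' : parityAut (1 - B) = 1 - B := by rw [map_sub, map_one, hB]
  have hmB' : ω.expect X (1 - B) = ((1 - m₁ : ℝ) : ℂ) := by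
    rw [map_sub, ω.expect_one, hmB]; push_cast; ring
  have h := herg.limUnder_eq_of_limitStates hω0 (by linarith : 0 < 1 - m₁) (by ring) h𝒰
    (hω.exists_limitState_boxPairAverage hd hB hB0 hω0 hmB 𝒰 h𝒰)
    (hω.exists_limitState_boxPairAverage hd hB' hB1 (by linarith) hmB' 𝒰 h𝒰)
    (fun Λ A => ⟨‖A‖ * ‖B‖, fun N => ω.norm_boxPairAverage_le N A B⟩)
    (fun Λ A => ⟨‖A‖ * ‖1 - B‖, fun N => ω.norm_boxPairAverage_le N A (1 - B)⟩) ?_ Λ A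
  · rw [h, hmB]
  · intro Λ' A'
    filter_upwards [eventually_ne_atTop 0] with N hN
    have hc : ((N : ℂ) ^ d) ^ 2 ≠ 0 := pow_ne_zero _ (pow_ne_zero _ (Nat.cast_ne_zero.2 hN))
    rw [← mul_add, boxPairSum_sub_right, add_sub_cancel, boxPairSum_one_right, ← mul_assoc,
      inv_mul_cancel₀ hc, one_mul]

/-- **The order-restricted core**: for `ω` ergodic and an even `B` with `0 ⪯ B ⪯ 𝟙`,
`0 < ω(B) < 1`: `N^{-2d} Σ_{x,y ∈ [0,N)^d} ω(A · τ_{y-x} B) → ω(A) ω(B)`.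
[cite: BratteliRobinsonI1987, Thm. 4.3.17 and Thm. 4.3.22 (PDF pp. 395, 401)] -/
theorem IsErgodic.tendsto_boxPairAverage_of_posSemidef (herg : ω.IsErgodic) (hd : 0 < d)
    {X : Finset (Site d)} {B : FermionOp X} (hB : parityAut B = B) (hB0 : B.PosSemidef)
    (hB1 : (1 - B).PosSemidef) (hω0 : 0 < (ω.expect X B).re) (hω1 : (ω.expect X B).re < 1)
    (Λ : Finset (Site d)) (A : FermionOp Λ) :
    Tendsto (fun N : ℕ => (((N : ℂ) ^ d) ^ 2)⁻¹ *
        ∑ x ∈ halfOpenBox d N, ∑ y ∈ halfOpenBox d N,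
          ω.corr A (fermionEmbed (PolySite.shiftEmb (y - x) X) B)) atTop
      (𝓝 (ω.expect Λ A * ω.expect X B)) := by
  rw [tendsto_iff_ultrafilter]
  intro 𝒰 h𝒰
  have h := tendsto_limUnder_of_norm_le 𝒰 (fun N => ω.norm_boxPairAverage_le N A B)
  rwa [herg.limUnder_boxPairAverage_eq_of_posSemidef hd hB hB0 hB1 hω0 hω1 h𝒰 Λ A, mul_comm] at h

/-- The box-pair averages against `𝟙` converge to `ω(A)` (they equal it for `N ≥ 1`). [folklore] -/
private theorem tendsto_boxPairAverage_one (ω : InfVolFermionState d) {X : Finset (Site d)}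
    (Λ : Finset (Site d)) (A : FermionOp Λ) :
    Tendsto (fun N : ℕ => (((N : ℂ) ^ d) ^ 2)⁻¹ *
        ∑ x ∈ halfOpenBox d N, ∑ y ∈ halfOpenBox d N,
          ω.corr A (fermionEmbed (PolySite.shiftEmb (y - x) X) (1 : FermionOp X))) atTop
      (𝓝 (ω.expect Λ A)) := by
  refine tendsto_const_nhds.congr' ?_
  filter_upwards [eventually_ne_atTop 0] with N hN
  have hc : ((N : ℂ) ^ d) ^ 2 ≠ 0 := pow_ne_zero _ (pow_ne_zero _ (Nat.cast_ne_zero.2 hN))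
  rw [boxPairSum_one_right, ← mul_assoc, inv_mul_cancel₀ hc, one_mul]

/-- **The Hermitian case**: for `ω` ergodic and an even Hermitian `H`,
`N^{-2d} Σ_{x,y} ω(A · τ_{y-x} H) → ω(A) ω(H)` — apply the core to
`B' = ½𝟙 + (4‖H‖+1)⁻¹ H`, which satisfies `¼𝟙 ⪯ B' ⪯ ¾𝟙`, and use linearity in `B`.
[cite: BratteliRobinsonI1987, Thm. 4.3.17 and Thm. 4.3.22 (PDF pp. 395, 401)] -/
theorem IsErgodic.tendsto_boxPairAverage_of_isHermitian (herg : ω.IsErgodic) (hd : 0 < d)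
    {X : Finset (Site d)} {H : FermionOp X} (hH : parityAut H = H) (hHh : H.IsHermitian)
    (Λ : Finset (Site d)) (A : FermionOp Λ) :
    Tendsto (fun N : ℕ => (((N : ℂ) ^ d) ^ 2)⁻¹ *
        ∑ x ∈ halfOpenBox d N, ∑ y ∈ halfOpenBox d N,
          ω.corr A (fermionEmbed (PolySite.shiftEmb (y - x) X) H)) atTop
      (𝓝 (ω.expect Λ A * ω.expect X H)) := by
  classical
  -- the rescaled observable `B' = ½𝟙 + r H`, `r = (4‖H‖+1)⁻¹`
  set r : ℝ := (4 * ‖H‖ + 1)⁻¹ with hr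
  have hr0 : 0 < r := by rw [hr]; positivity
  have hrC : (r : ℂ) ≠ 0 := Complex.ofReal_ne_zero.2 hr0.ne'
  set K : FermionOp X := (r : ℂ) • H with hK
  have hKh : K.IsHermitian := hHh.smul (isSelfAdjoint_real_toComplex r)
  have hKn : ‖K‖ ≤ 1 / 4 := by
    rw [hK, norm_smul, Complex.norm_real, Real.norm_eq_abs, abs_of_pos hr0, hr]
    rw [inv_mul_le_iff₀ (by positivity)]
    linarith [norm_nonneg H]
  set B' : FermionOp X := ((1 / 2 : ℝ) : ℂ) • (1 : FermionOp X) + K with hB'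
  have hB'even : parityAut B' = B' := by
    rw [hB', map_add, map_smul, map_one, hK, map_smul, hH]
  have hdec1 : B' = ((1 / 2 - ‖K‖ : ℝ) : ℂ) • (1 : FermionOp X) + ((‖K‖ : ℂ) • 1 + K) := by
    rw [hB']
    push_cast
    module
  have hdec2 : 1 - B' = ((1 / 2 - ‖K‖ : ℝ) : ℂ) • (1 : FermionOp X) + ((‖K‖ : ℂ) • 1 - K) := by
    rw [hB']
    push_cast
    module
  have hcoef : (0 : ℂ) ≤ ((1 / 2 - ‖K‖ : ℝ) : ℂ) := Complex.zero_le_real.2 (by linarith)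
  have hB'0 : B'.PosSemidef := by
    rw [hdec1]
    exact (Matrix.PosSemidef.one.smul hcoef).add (posSemidef_norm_smul_one_add_of_isHermitian hKh)
  have hB'1 : (1 - B').PosSemidef := by
    rw [hdec2]
    exact (Matrix.PosSemidef.one.smul hcoef).add (posSemidef_norm_smul_one_sub_of_isHermitian hKh)
  have hωB' : ω.expect X B' = (1 / 2 : ℂ) + (r : ℂ) * ω.expect X H := by
    rw [hB', map_add, map_smul, ω.expect_one, hK, map_smul, smul_eq_mul, mul_one, smul_eq_mul]
    push_cast
    ring
  have hωK : ‖(r : ℂ) * ω.expect X H‖ ≤ 1 / 4 := by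
    have h := ω.norm_expect_le X K
    rw [hK, map_smul, smul_eq_mul] at h
    exact h.trans hKn
  have hre : (ω.expect X B').re = 1 / 2 + ((r : ℂ) * ω.expect X H).re := by
    rw [hωB', Complex.add_re]
    norm_num
  have habs := (Complex.abs_re_le_norm ((r : ℂ) * ω.expect X H)).trans hωK
  have hω0 : 0 < (ω.expect X B').re := by
    rw [hre]; linarith [neg_abs_le ((r : ℂ) * ω.expect X H).re]
  have hω1 : (ω.expect X B').re < 1 := by
    rw [hre]; linarith [le_abs_self ((r : ℂ) * ω.expect X H).re]
  have hlimB' := herg.tendsto_boxPairAverage_of_posSemidef hd hB'even hB'0 hB'1 hω0 hω1 Λ A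
  have hlim1 := ω.tendsto_boxPairAverage_one (X := X) Λ A
  -- linearity in `B`: `S(H) = r⁻¹ (S(B') - ½ S(𝟙))`
  have key : ∀ N : ℕ, (((N : ℂ) ^ d) ^ 2)⁻¹ *
      ∑ x ∈ halfOpenBox d N, ∑ y ∈ halfOpenBox d N,
        ω.corr A (fermionEmbed (PolySite.shiftEmb (y - x) X) H) =
      (r : ℂ)⁻¹ * ((((N : ℂ) ^ d) ^ 2)⁻¹ *
        ∑ x ∈ halfOpenBox d N, ∑ y ∈ halfOpenBox d N,
          ω.corr A (fermionEmbed (PolySite.shiftEmb (y - x) X) B') -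
        (1 / 2 : ℂ) * ((((N : ℂ) ^ d) ^ 2)⁻¹ *
          ∑ x ∈ halfOpenBox d N, ∑ y ∈ halfOpenBox d N,
            ω.corr A (fermionEmbed (PolySite.shiftEmb (y - x) X) (1 : FermionOp X)))) := by
    intro N
    rw [hB', boxPairSum_add_right, boxPairSum_smul_right, hK, boxPairSum_smul_right]
    push_cast
    field_simp
    ring
  have hlim := (hlimB'.sub (hlim1.const_mul (1 / 2 : ℂ))).const_mul (r : ℂ)⁻¹
  have hval : (r : ℂ)⁻¹ * (ω.expect Λ A * ω.expect X B' - 1 / 2 * ω.expect Λ A) =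
      ω.expect Λ A * ω.expect X H := by
    rw [hωB']
    field_simp
    ring
  rw [← hval]
  exact hlim.congr fun N => (key N).symm

/-- **Bratteli–Robinson I Thm. 4.3.17 / 4.3.22 for the lattice fermions (ergodic ⇒ weakly mixing
in mean over boxes).** For a translation-ERGODIC state `ω` on `ℤ^d` (`d ≥ 1`), an EVEN local
observable `B ∈ 𝔄_X` and any local `A ∈ 𝔄_Λ`,
`N^{-2d} Σ_{x, y ∈ [0,N)^d} ω(A · τ_{y-x} B) ⟶ ω(A) ω(B)` as `N → ∞`
(the Fejér/box-pair form of the cluster property in mean; `B = H₁ + i H₂` with `H₁, H₂` even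
Hermitian reduces to the Hermitian case). [cite: BratteliRobinsonI1987, Thm. 4.3.17 and Thm. 4.3.22 (PDF pp. 395, 401)] -/
theorem IsErgodic.tendsto_boxPairAverage_corr (herg : ω.IsErgodic) (hd : 0 < d)
    {X : Finset (Site d)} {B : FermionOp X} (hB : parityAut B = B) (Λ : Finset (Site d))
    (A : FermionOp Λ) :
    Tendsto (fun N : ℕ => (((N : ℂ) ^ d) ^ 2)⁻¹ *
        ∑ x ∈ halfOpenBox d N, ∑ y ∈ halfOpenBox d N,
          ω.corr A (fermionEmbed (PolySite.shiftEmb (y - x) X) B)) atTop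
      (𝓝 (ω.expect Λ A * ω.expect X B)) := by
  classical
  -- Hermitian and anti-Hermitian parts
  set H₁ : FermionOp X := (1 / 2 : ℂ) • (B + Bᴴ) with hH₁
  set H₂ : FermionOp X := (-Complex.I / 2) • (B - Bᴴ) with hH₂
  have hBh : parityAut Bᴴ = Bᴴ := by rw [parityAut_conjTranspose, hB]
  have hH₁e : parityAut H₁ = H₁ := by rw [hH₁, map_smul, map_add, hB, hBh]
  have hH₂e : parityAut H₂ = H₂ := by rw [hH₂, map_smul, map_sub, hB, hBh]
  have hH₁h : H₁.IsHermitian := by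
    rw [hH₁]
    exact (Matrix.isHermitian_add_transpose_self B).smul (by
      rw [show (1 / 2 : ℂ) = ((1 / 2 : ℝ) : ℂ) by push_cast; ring]; exact isSelfAdjoint_real_toComplex _)
  have hH₂h : H₂.IsHermitian := by
    have hstar : star (-Complex.I / 2) = - (-Complex.I / 2) := by
      rw [Complex.star_def, map_div₀, map_neg, Complex.conj_I, neg_neg, neg_div, neg_neg,
        map_ofNat]
    rw [Matrix.IsHermitian, hH₂, conjTranspose_smul, conjTranspose_sub, conjTranspose_conjTranspose,
      hstar, neg_smul, ← smul_neg, neg_sub]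
  have hdec : H₁ + Complex.I • H₂ = B := by
    rw [hH₁, hH₂, smul_smul, show Complex.I * (-Complex.I / 2) = 1 / 2 by
      rw [mul_div_assoc', mul_neg, Complex.I_mul_I, neg_neg]]
    module
  clear_value H₁ H₂
  have h₁ := herg.tendsto_boxPairAverage_of_isHermitian hd hH₁e hH₁h Λ A
  have h₂ := herg.tendsto_boxPairAverage_of_isHermitian hd hH₂e hH₂h Λ A
  have key : ∀ N : ℕ, (((N : ℂ) ^ d) ^ 2)⁻¹ *
      ∑ x ∈ halfOpenBox d N, ∑ y ∈ halfOpenBox d N,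
        ω.corr A (fermionEmbed (PolySite.shiftEmb (y - x) X) B) =
      (((N : ℂ) ^ d) ^ 2)⁻¹ *
        ∑ x ∈ halfOpenBox d N, ∑ y ∈ halfOpenBox d N,
          ω.corr A (fermionEmbed (PolySite.shiftEmb (y - x) X) H₁) +
      Complex.I * ((((N : ℂ) ^ d) ^ 2)⁻¹ *
        ∑ x ∈ halfOpenBox d N, ∑ y ∈ halfOpenBox d N,
          ω.corr A (fermionEmbed (PolySite.shiftEmb (y - x) X) H₂)) := by
    intro N
    rw [← hdec, boxPairSum_add_right, boxPairSum_smul_right]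
    ring
  have hval : ω.expect Λ A * ω.expect X H₁ + Complex.I * (ω.expect Λ A * ω.expect X H₂) =
      ω.expect Λ A * ω.expect X B := by
    rw [← hdec, map_add, map_smul, smul_eq_mul]
    ring
  rw [← hval]
  exact (h₁.add (h₂.const_mul Complex.I)).congr fun N => (key N).symm

end Cluster

end InfVolFermionState

/-! ### §7. Discharge of `ergodic_pairCorr_boxAverage` -/

/-- The local singlet pair `P_x` is EVEN (`Θ P_x = P_x`: a sum of products of two annihilation
operators). [cite: BratteliRobinsonII1997, §5.2.2] -/
theorem parityAut_localPairAt (S : Finset (Site 2)) (g : Site 2 → ℝ) (x : Site 2) :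
    parityAut (localPairAt S g x) = localPairAt S g x := by
  unfold localPairAt
  simp only [map_sum, map_smul, map_sub, map_mul, cAt, parityAut_annihilation, neg_mul_neg]

namespace InfVolFermionState

/-- For a translation-invariant state the pair two-point function at `(x, y)` is the one at
`(0, y - x)`. [cite: Sewell1970, §4] -/
theorem IsTranslationInvariant.pairCorr_eq_pairCorr_zero {ω : InfVolFermionState 2}
    (hω : ω.IsTranslationInvariant) (S : Finset (Site 2)) (g : Site 2 → ℝ) (x y : Site 2) :
    ω.pairCorr S g x y = ω.pairCorr S g 0 (y - x) := by
  have h := hω.pairCorr_add S g 0 (y - x) x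
  rw [zero_add, sub_add_cancel] at h
  exact h

/-- The pair two-point function at `(0, z)` is `ω(P_0⋆ · τ_z P_0)` (the translate of `P_0` by `z`
is `P_z`, up to isotony). [folklore] -/
private theorem corr_localPairAt_conjTranspose_shiftEmb (ω : InfVolFermionState 2) (S : Finset (Site 2))
    (g : Site 2 → ℝ) (z : Site 2) :
    ω.corr (localPairAt S g 0)ᴴ
        (fermionEmbed (PolySite.shiftEmb z (pairRegion S 0)) (localPairAt S g 0)) =
      ω.pairCorr S g 0 z := by
  rw [fermionEmbed_shiftEmb_localPairAt, corr_fermionEmbed_incl_right, pairCorr, zero_add]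

/-- **Discharge of the named fact `ergodic_pairCorr_boxAverage`** (Bratteli–Robinson I
Thm. 4.3.17 with Prop. 4.3.4 / Thm. 4.3.22 for the `ℤ²`-abelian pair (CAR algebra,
translation-invariant state), Bratteli–Robinson II Ex. 5.2.21): for a translation-ERGODIC state
`ω` of the lattice fermions on `ℤ²` and the local singlet pairs `P_x`,
`N⁻⁴ Σ_{x, y ∈ [0,N)²} ω(P_x⋆ P_y) ⟶ |ω(P_0)|²`. Proof: `IsErgodic.tendsto_boxPairAverage_corr`
with `A = P_0⋆`, `B = P_0` (even), and `ω(P_x⋆ P_y) = ω(P_0⋆ · τ_{y-x} P_0)` by translation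
invariance. [cite: BratteliRobinsonI1987, Thm. 4.3.17 and Prop. 4.3.4 (PDF pp. 395, 377)] -/
theorem ergodic_pairCorr_boxAverage_holds : ergodic_pairCorr_boxAverage := by
  intro ω herg S g
  have hω := herg.isTranslationInvariant
  have h := herg.tendsto_boxPairAverage_corr (by norm_num : 0 < 2) (parityAut_localPairAt S g 0)
    (pairRegion S 0) (localPairAt S g 0)ᴴ
  have hval : ω.expect (pairRegion S 0) (localPairAt S g 0)ᴴ *
      ω.expect (pairRegion S 0) (localPairAt S g 0) =
      (((‖ω.expect (pairRegion S 0) (localPairAt S g 0)‖ ^ 2 : ℝ)) : ℂ) := by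
    rw [expect_conjTranspose, Complex.star_def, Complex.conj_mul']
    push_cast
    rfl
  rw [hval] at h
  refine h.congr fun N => ?_
  rw [show ((N : ℂ) ^ 2) ^ 2 = (N : ℂ) ^ 4 by rw [← pow_mul]]
  congr 1
  refine sum_congr rfl fun x _ => sum_congr rfl fun y _ => ?_
  rw [corr_localPairAt_conjTranspose_shiftEmb, ← hω.pairCorr_eq_pairCorr_zero]

end InfVolFermionState

/-! ### §8. Unconditional forms of the consumers of the fact -/

namespace InfVolFermionState

/-- **Ergodic states have no ODLRO beyond `|ω(P_0)|²`** — the fact `ergodic_pairCorr_boxAverage`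
as a theorem with explicit arguments: for `ω` translation-ergodic on `ℤ²`,
`N⁻⁴ Σ_{x, y ∈ [0,N)²} ω(P_x⋆ P_y) ⟶ |ω(P_0)|²`.
[cite: BratteliRobinsonI1987, Thm. 4.3.17 and Prop. 4.3.4 (PDF pp. 395, 377)] -/
theorem IsErgodic.tendsto_pairCorr_boxAverage {ω : InfVolFermionState 2} (herg : ω.IsErgodic)
    (S : Finset (Site 2)) (g : Site 2 → ℝ) :
    Tendsto (fun N : ℕ => ((N : ℂ) ^ 4)⁻¹ *
        ∑ x ∈ halfOpenBox 2 N, ∑ y ∈ halfOpenBox 2 N, ω.pairCorr S g x y) atTop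
      (𝓝 (((‖ω.expect (pairRegion S 0) (localPairAt S g 0)‖ ^ 2 : ℝ) : ℂ))) :=
  ergodic_pairCorr_boxAverage_holds ω herg S g

/-- **ODLRO forces non-ergodicity** (unconditional form of `not_isErgodic_of_odlro`, Sewell 1970
§4 / Bratteli–Robinson I Thm. 4.3.17 contrapositive): a translation-invariant state with vanishing
pair amplitude `ω(P_0) = 0` (e.g. a gauge-invariant one) whose box averages of the pair two-point
function stay `≥ c > 0` is NOT translation-ergodic — it is a non-trivial mixture of
translation-invariant states. [cite: BratteliRobinsonI1987, Thm. 4.3.17 (contrapositive; PDF p. 395)] -/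
theorem not_isErgodic_of_odlro_holds {ω : InfVolFermionState 2} {S : Finset (Site 2)}
    {g : Site 2 → ℝ} (h0 : ω.expect (pairRegion S 0) (localPairAt S g 0) = 0) {c : ℝ} (hc : 0 < c)
    (hodlro : ∀ᶠ N : ℕ in atTop, c ≤ (((N : ℂ) ^ 4)⁻¹ *
        ∑ x ∈ halfOpenBox 2 N, ∑ y ∈ halfOpenBox 2 N, ω.pairCorr S g x y).re) :
    ¬ ω.IsErgodic :=
  not_isErgodic_of_odlro ergodic_pairCorr_boxAverage_holds h0 hc hodlro

end InfVolFermionState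

end Literature.MathematicalPhysics.QuantumLattice

end
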